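import Mathlib.FieldTheory.Finite.GaloisField
import Literature.Computability.MetaComplexity.NWDesignAC0Mod
import HarnessLib

/-!
# NW designs computable in `AC⁰[p]`: the parameters of CIKK Thm. 3.3

Sequel of `NWDesignAC0Mod.lean`, which analyses the polynomial design over an ARBITRARY field
`K ⊇ 𝔽_p` with a basis. This file fixes the field as CIKK do ("an extension field over `GF(p)` of
the least size so that `|F| ≥ n`; … of size at most `pn`") and records the resulting parameters
(CIKK Thm. 3.3 / 3.7): for every prime `p`, block size `N` and index length `ℓ`,

* `extDeg p N = ⌊log_p N⌋ + 1`, `Fld p N = GaloisField p (extDeg p N)` with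
  `N < |Fld p N| ≤ p · N` (for `N ≥ 1`), the evaluation points `evalPts p N : Fin N ↪ Fld p N`, a
  basis `basisFld p N` over `𝔽_p` with `extDeg p N` coordinates;
* `cikkDesignP p N ℓ` — the design `v ↦ S_v ⊆ Fld × Fld` of `2^ℓ` blocks of size `N` in a universe
  of `|Fld|² ≤ p² N²` points with pairwise intersections `≤ ℓ` (`isNWDesign_cikkDesignP`,
  `card_universe_le`);
* **`acRealOver_cikkDesignP`** — every seed coordinate `v ↦ z(S_v(i))` is computed by a circuit over
  `{¬, ∧, ∨, MOD_p}` of depth `4` and size `≤ p·N·((⌊log_p N⌋+1)((ℓ+1)(p-1)+2)+2)+1`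
  (`coordSize_le`).

All statements are proved; no named facts are introduced.

## References

* M. Carmosino, R. Impagliazzo, V. Kabanets, A. Kolokolova, *Learning algorithms from natural
  proofs*, CCC 2016, LIPIcs 50, Thms. 3.3, 3.6, 3.7 [CarmosinoImpagliazzoKabanetsKolokolova2016].
-/

namespace Literature.Computability.MetaComplexity

open Finset Literature.Computability.Complexity

namespace GFDesign

variable (p : ℕ) [hp : Fact p.Prime]

/-! ### The field -/

/-- The extension degree: `t = ⌊log_p N⌋ + 1`, so that `N < p^t ≤ p · N`. [cite: CarmosinoImpagliazzoKabanetsKolokolova2016, Thm. 3.6 (proof: "a polynomial over GF(p) of degree O(log_p n)")] -/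
def extDeg (p N : ℕ) : ℕ := Nat.log p N + 1

/-- `N < p^t`. [folklore] -/
theorem lt_pow_extDeg (N : ℕ) : N < p ^ extDeg p N := Nat.lt_pow_succ_log_self hp.out.one_lt N

omit hp in
/-- `p^t ≤ p · N` for `N ≥ 1`. [folklore] -/
theorem pow_extDeg_le {N : ℕ} (hN : N ≠ 0) : p ^ extDeg p N ≤ p * N := by
  rw [extDeg, pow_succ, mul_comm]
  exact Nat.mul_le_mul_left _ (Nat.pow_log_le_self p hN)

/-- The field `F = GF(p^t)` of the design. [cite: CarmosinoImpagliazzoKabanetsKolokolova2016, Thm. 3.6 (proof)] -/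
abbrev Fld (p N : ℕ) [Fact p.Prime] : Type := GaloisField p (extDeg p N)

/-- The field is finite (classically enumerated). [folklore] -/
noncomputable instance instFintypeFld (N : ℕ) : Fintype (Fld p N) := Fintype.ofFinite _

/-- Equality in the field is (classically) decidable. [folklore] -/
noncomputable instance instDecidableEqFld (N : ℕ) : DecidableEq (Fld p N) := Classical.decEq _

/-- `|F| = p^t`. [folklore] -/
theorem card_Fld (N : ℕ) : Fintype.card (Fld p N) = p ^ extDeg p N := by
  rw [← Nat.card_eq_fintype_card]
  exact GaloisField.card p _ (Nat.succ_ne_zero _)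

/-- `N < |F|`. [folklore] -/
theorem lt_card_Fld (N : ℕ) : N < Fintype.card (Fld p N) := by
  rw [card_Fld]; exact lt_pow_extDeg p N

/-- `|F| ≤ p · N` for `N ≥ 1` (CIKK: "of size at most `pn`"). [cite: CarmosinoImpagliazzoKabanetsKolokolova2016, Thm. 3.6 (proof)] -/
theorem card_Fld_le {N : ℕ} (hN : N ≠ 0) : Fintype.card (Fld p N) ≤ p * N := by
  rw [card_Fld]; exact pow_extDeg_le p hN

/-- The evaluation points: the first `N` field elements in a fixed enumeration (CIKK: "the first
`n` field elements `r₁, …, rₙ`"). [cite: CarmosinoImpagliazzoKabanetsKolokolova2016, §3.1] -/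
noncomputable def evalPts (N : ℕ) : Fin N ↪ Fld p N :=
  (Fin.castLEEmb (lt_card_Fld p N).le).trans (Fintype.equivFin (Fld p N)).symm.toEmbedding

/-- A basis of `F` over `𝔽_p` with `t` coordinates. [folklore] -/
noncomputable def basisFld (N : ℕ) : Module.Basis (Fin (extDeg p N)) (ZMod p) (Fld p N) :=
  Module.finBasisOfFinrankEq (ZMod p) (Fld p N) (GaloisField.finrank p (Nat.succ_ne_zero _))

/-! ### The design with the CIKK parameters -/

/-- **The `AC⁰[p]`-computable NW design of CIKK Thm. 3.3**: `2^ℓ` blocks of size `N` in the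
universe `F × F`, block `v` the graph of the `0/1`-coefficient polynomial `A_v` on the first `N`
field elements. [cite: CarmosinoImpagliazzoKabanetsKolokolova2016, Thm. 3.3] -/
noncomputable def cikkDesignP (N ℓ : ℕ) : (Fin ℓ → Bool) → (Fin N ↪ Fld p N × Fld p N) :=
  design (evalPts p N) ℓ

/-- Pairwise intersections are `≤ ℓ`. [cite: CarmosinoImpagliazzoKabanetsKolokolova2016, Thm. 3.3] -/
theorem isNWDesign_cikkDesignP (N ℓ : ℕ) : IsNWDesign ℓ (cikkDesignP p N ℓ) :=
  isNWDesign_design _ ℓ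

/-- The universe has `≤ p² N²` points (`m = O(n²)` for fixed `p`). [cite: CarmosinoImpagliazzoKabanetsKolokolova2016, Thm. 3.3 ("m = O(n²)")] -/
theorem card_universe_le {N : ℕ} (hN : N ≠ 0) :
    Fintype.card (Fld p N × Fld p N) ≤ (p * N) ^ 2 := by
  rw [Fintype.card_prod, sq]
  exact Nat.mul_le_mul (card_Fld_le p hN) (card_Fld_le p hN)

/-- The size of a seed-coordinate circuit with the CIKK parameters is polynomial:
`coordSize |F| t ℓ p ≤ p·N·((⌊log_p N⌋+1)((ℓ+1)(p-1)+2)+2) + 1`. [folklore] -/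
theorem coordSize_le {N : ℕ} (hN : N ≠ 0) (ℓ : ℕ) :
    coordSize (Fintype.card (Fld p N)) (extDeg p N) ℓ p ≤
      p * N * ((Nat.log p N + 1) * ((ℓ + 1) * (p - 1) + 2) + 2) + 1 := by
  unfold coordSize eqTestSize extDeg
  have h := card_Fld_le p hN
  exact Nat.succ_le_succ (Nat.mul_le_mul h le_rfl)

/-- **CIKK Thm. 3.3 / 3.7 (the restriction map is in `AC⁰[p]`)**: for every prime `p`, block size
`N`, index length `ℓ`, seed `z` and block position `i`, the bit `v ↦ z(S_v(i))` of the design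
`cikkDesignP p N ℓ` is computed by a circuit over `{¬, ∧, ∨, MOD_p}` of depth `4` and size
`≤ p·N·((⌊log_p N⌋+1)((ℓ+1)(p-1)+2)+2) + 1`. [cite: CarmosinoImpagliazzoKabanetsKolokolova2016, Thm. 3.7] -/
theorem acRealOver_cikkDesignP {N : ℕ} (hN : N ≠ 0) (ℓ : ℕ) (z : Fld p N × Fld p N → Bool) (i : Fin N) :
    ACRealOver (accBasis p) (fun v : Fin ℓ → Bool => z (cikkDesignP p N ℓ v i)) 4
      (p * N * ((Nat.log p N + 1) * ((ℓ + 1) * (p - 1) + 2) + 2) + 1) :=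
  (acRealOver_design (basisFld p N) (evalPts p N) z i).mono le_rfl (coordSize_le p hN ℓ)

/-- The same, as a genuine circuit. [cite: CarmosinoImpagliazzoKabanetsKolokolova2016, Thm. 3.7] -/
theorem exists_circuit_cikkDesignP {N : ℕ} (hN : N ≠ 0) (ℓ : ℕ) (z : Fld p N × Fld p N → Bool) (i : Fin N) :
    ∃ C : Circuit (Fin ℓ), C.IsOver (accBasis p) ∧ C.acDepth ≤ 4 ∧
      C.size ≤ p * N * ((Nat.log p N + 1) * ((ℓ + 1) * (p - 1) + 2) + 2) + 1 ∧
        C.Computes fun v => z (cikkDesignP p N ℓ v i) :=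
  (acRealOver_cikkDesignP p hN ℓ z i).toCircuit

end GFDesign

end Literature.Computability.MetaComplexity
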